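import Mathlib

/-!
# `𝔸²ⁿ/(J₂ ⊕ ⋯ ⊕ J₂)`: order, centre and augmentation ideals of `n` Jordan blocks of size `2` (chain w45c, programme T, stretch)

(crux stmt-ResolutionOfSingularities-15640 `WildQuotients.WildQuotientResolution`, line `Sketch`,
programme «INSTANTIATE T1», stretch `𝔸²ⁿ/(J₂^{⊕n})` of `L/w45c/CHAIN.md` §5 — for `n ≥ 3` these
quotients are NOT Cohen–Macaulay (Ellingsrud–Skjelbred); [OURS · L1 W4.5c] — NOT a statement of
any manuscript.)

The `k`-algebra automorphism `σ` of `k[x_{0,i}, x_{1,i} : i < n]` (`MvPolynomial (Fin 2 × Fin n) k`)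
with `σ x_{0,i} = x_{0,i}`, `σ x_{1,i} = x_{1,i} + x_{0,i}` — the direct sum of `n` unipotent Jordan
blocks of size `2` — over a field of characteristic `p`:
* `nBlocks_pow_apply_X` — `σᵐ x_{0,i} = x_{0,i}`, `σᵐ x_{1,i} = x_{1,i} + m x_{0,i}`;
* `nBlocks_order` — `σ ^ p = 1`, `σ ≠ 1` (for `n ≥ 1`), `|⟨σ⟩| = p`, in every characteristic `p`;
* `smul_X_fst` — the centre generators `x_{0,i}` are fixed by `⟨σ⟩`; `smul_centre_eq` — the centre
  `I = (x_{0,i} : i)` is `⟨σ⟩`-stable;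
* `smul_sub_mem_centre` — `g • r - r ∈ I` for all `g ∈ ⟨σ⟩` and all `r` (any field);
* `X_fst_mem_augIdeal`, `augIdeal_eq_centre` — for `g ≠ 1`, `⟨g • r - r : r⟩ = I` (the fixed locus
  `V(I)` has codimension `n`: `𝔸²ⁿ` is not a terminal model; programme T blows `I` up).
The case `n = 2` in coordinates `Fin 4` is `…Theorems.WildQuotientResolution.TwoBlocks`.
-/

-- single-problem summit: the doubled namespace component `ResolutionOfSingularities` is forced
set_option linter.dupNamespace false

noncomputable section

open MvPolynomial
open scoped Pointwise

namespace Summit.ResolutionOfSingularities.ResolutionOfSingularities.Theorems.WildQuotientResolution.NBlocks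

variable (k : Type) [Field k] (n : ℕ)
  (σ : MvPolynomial (Fin 2 × Fin n) k ≃ₐ[k] MvPolynomial (Fin 2 × Fin n) k)
  (h0 : ∀ i, σ (X (0, i)) = X (0, i)) (h1 : ∀ i, σ (X (1, i)) = X (1, i) + X (0, i))

include h0 h1 in
/-- **Iterates of `J₂^{⊕n}` on the coordinates**: `σᵐ x_{0,i} = x_{0,i}`,
`σᵐ x_{1,i} = x_{1,i} + m x_{0,i}`. [folklore] -/
theorem nBlocks_pow_apply_X (m : ℕ) (i : Fin n) :
    (σ ^ m) (X (0, i)) = X (0, i) ∧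
    (σ ^ m) (X (1, i)) = X (1, i) + (m : MvPolynomial (Fin 2 × Fin n) k) * X (0, i) := by
  induction m with
  | zero => constructor <;> simp
  | succ m ih =>
    obtain ⟨e0, e1⟩ := ih
    refine ⟨?_, ?_⟩
    · rw [pow_succ', AlgEquiv.mul_apply, e0, h0]
    · rw [pow_succ', AlgEquiv.mul_apply, e1, map_add, map_mul, map_natCast, h0, h1]
      push_cast
      ring

include h0 h1 in
/-- **Every `g ∈ ⟨σ⟩` fixes every coordinate `x_{0,i}` and moves `x_{1,i}` by a multiple of
`x_{0,i}` inside the centre**; as a first step: `σ` and `σ⁻¹` are congruent to the identity modulo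
the centre `I = (x_{0,i} : i)`, hence so is every integer power. [folklore] -/
theorem smul_sub_mem_centre (g : Subgroup.zpowers σ) (r : MvPolynomial (Fin 2 × Fin n) k) :
    g • r - r ∈ Ideal.span (Set.range fun i : Fin n => (X (0, i) : MvPolynomial (Fin 2 × Fin n) k)) := by
  classical
  set I : Ideal (MvPolynomial (Fin 2 × Fin n) k) :=
    Ideal.span (Set.range fun i : Fin n => (X (0, i) : MvPolynomial (Fin 2 × Fin n) k)) with hI
  obtain ⟨j, hj⟩ := Subgroup.mem_zpowers_iff.mp g.2
  -- `σ f - f ∈ I` for all `f`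
  have hσX : ∀ v : Fin 2 × Fin n, σ (X v) - X v ∈ I := by
    rintro ⟨a, i⟩
    match a with
    | 0 => rw [h0, sub_self]; exact Ideal.zero_mem _
    | 1 => rw [h1, add_sub_cancel_left]; exact Ideal.subset_span ⟨i, rfl⟩
  have hσf : ∀ f : MvPolynomial (Fin 2 × Fin n) k, σ f - f ∈ I := by
    intro f
    induction f using MvPolynomial.induction_on with
    | C c =>
      have hc : σ (C c) = C c := σ.commutes c
      rw [hc, sub_self]; exact Ideal.zero_mem _
    | add f f' hf hf' =>
      have : σ (f + f') - (f + f') = (σ f - f) + (σ f' - f') := by rw [map_add]; ring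
      rw [this]; exact Ideal.add_mem _ hf hf'
    | mul_X f v hf =>
      have : σ (f * X v) - f * X v = (σ f - f) * σ (X v) + f * (σ (X v) - X v) := by
        rw [map_mul]; ring
      rw [this]
      exact Ideal.add_mem _ (Ideal.mul_mem_right _ _ hf) (Ideal.mul_mem_left _ _ (hσX v))
  have hσinvf : ∀ f : MvPolynomial (Fin 2 × Fin n) k, σ⁻¹ f - f ∈ I := by
    intro f
    have h := hσf (σ⁻¹ f)
    have e : σ (σ⁻¹ f) = f := by rw [← AlgEquiv.mul_apply, mul_inv_cancel, AlgEquiv.one_apply]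
    rw [e] at h
    have : σ⁻¹ f - f = -(f - σ⁻¹ f) := by ring
    rw [this]
    exact neg_mem h
  have hzpow : ∀ (j : ℤ) (f : MvPolynomial (Fin 2 × Fin n) k), (σ ^ j) f - f ∈ I := by
    intro j
    induction j using Int.induction_on with
    | zero => intro f; rw [zpow_zero, AlgEquiv.one_apply, sub_self]; exact Ideal.zero_mem _
    | succ m ih =>
      intro f
      rw [zpow_add_one, AlgEquiv.mul_apply]
      have e : (σ ^ (m : ℤ)) (σ f) - f = ((σ ^ (m : ℤ)) (σ f) - σ f) + (σ f - f) := by ring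
      rw [e]
      exact Ideal.add_mem _ (ih (σ f)) (hσf f)
    | pred m ih =>
      intro f
      rw [zpow_sub_one, AlgEquiv.mul_apply]
      have e : (σ ^ (-(m : ℤ))) (σ⁻¹ f) - f =
          ((σ ^ (-(m : ℤ))) (σ⁻¹ f) - σ⁻¹ f) + (σ⁻¹ f - f) := by ring
      rw [e]
      exact Ideal.add_mem _ (ih (σ⁻¹ f)) (hσinvf f)
  change (g : MvPolynomial (Fin 2 × Fin n) k ≃ₐ[k] MvPolynomial (Fin 2 × Fin n) k) r - r ∈ I
  rw [← hj]
  exact hzpow j r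

include h0 in
/-- **The centre generators `x_{0,i}` are fixed by `⟨σ⟩`.** [folklore] -/
theorem smul_X_fst (g : Subgroup.zpowers σ) (i : Fin n) :
    g • (X (0, i) : MvPolynomial (Fin 2 × Fin n) k) = X (0, i) := by
  obtain ⟨j, hj⟩ := Subgroup.mem_zpowers_iff.mp g.2
  change (g : MvPolynomial (Fin 2 × Fin n) k ≃ₐ[k] MvPolynomial (Fin 2 × Fin n) k) (X (0, i)) = _
  rw [← hj]
  have hfix : σ • (X (0, i) : MvPolynomial (Fin 2 × Fin n) k) = X (0, i) := h0 i
  exact MulAction.fixedBy_subset_fixedBy_zpow (MvPolynomial (Fin 2 × Fin n) k) σ j hfix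

include h0 in
/-- **The centre `I = (x_{0,i} : i)` is `⟨σ⟩`-stable**: `g • I = I`. [folklore] -/
theorem smul_centre_eq (g : Subgroup.zpowers σ) :
    g • Ideal.span (Set.range fun i : Fin n => (X (0, i) : MvPolynomial (Fin 2 × Fin n) k)) =
      Ideal.span (Set.range fun i : Fin n => (X (0, i) : MvPolynomial (Fin 2 × Fin n) k)) := by
  -- first for `σ` itself, as an identity of images of the generators
  have hσ : Ideal.map (σ : MvPolynomial (Fin 2 × Fin n) k →+* MvPolynomial (Fin 2 × Fin n) k)
      (Ideal.span (Set.range fun i : Fin n => (X (0, i) : MvPolynomial (Fin 2 × Fin n) k))) =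
        Ideal.span (Set.range fun i : Fin n => (X (0, i) : MvPolynomial (Fin 2 × Fin n) k)) := by
    rw [Ideal.map_span, ← Set.range_comp]
    congr 1
    ext f
    simp only [Set.mem_range, Function.comp_apply, RingHom.coe_coe, h0]
  have hσ' : σ • Ideal.span (Set.range fun i : Fin n => (X (0, i) : MvPolynomial (Fin 2 × Fin n) k)) =
      Ideal.span (Set.range fun i : Fin n => (X (0, i) : MvPolynomial (Fin 2 × Fin n) k)) := hσ
  obtain ⟨j, hj⟩ := Subgroup.mem_zpowers_iff.mp g.2
  change (g : MvPolynomial (Fin 2 × Fin n) k ≃ₐ[k] MvPolynomial (Fin 2 × Fin n) k) •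
      Ideal.span (Set.range fun i : Fin n => (X (0, i) : MvPolynomial (Fin 2 × Fin n) k)) = _
  rw [← hj]
  exact MulAction.fixedBy_subset_fixedBy_zpow (Ideal (MvPolynomial (Fin 2 × Fin n) k)) σ j hσ'

include h0 h1 in
/-- **Order of `J₂^{⊕n}`**: over a field of characteristic `p` (ANY prime `p`) and for `n ≥ 1`,
`σ ^ p = 1`, `σ ≠ 1` and `Subgroup.zpowers σ` has exactly `p` elements. [folklore] -/
theorem nBlocks_order (p : ℕ) (hp : p.Prime) [CharP k p] (hn : 0 < n) :
    σ ^ p = 1 ∧ σ ≠ 1 ∧ Nat.card (Subgroup.zpowers σ) = p := by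
  classical
  haveI : Fact p.Prime := ⟨hp⟩
  have hp0 : (p : MvPolynomial (Fin 2 × Fin n) k) = 0 := CharP.cast_eq_zero _ p
  have hpow : σ ^ p = 1 := by
    have key : ((σ ^ p : MvPolynomial (Fin 2 × Fin n) k ≃ₐ[k] MvPolynomial (Fin 2 × Fin n) k) :
        MvPolynomial (Fin 2 × Fin n) k →ₐ[k] MvPolynomial (Fin 2 × Fin n) k) = AlgHom.id k _ := by
      refine MvPolynomial.algHom_ext fun v => ?_
      change (σ ^ p) (X v) = X v
      obtain ⟨a, i⟩ := v
      obtain ⟨e0, e1⟩ := nBlocks_pow_apply_X k n σ h0 h1 p i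
      match a with
      | 0 => exact e0
      | 1 =>
        rw [hp0, zero_mul, add_zero] at e1
        exact e1
    apply AlgEquiv.ext
    intro a
    have := DFunLike.congr_fun key a
    simpa using this
  have hne : σ ≠ 1 := by
    intro h
    have h1' := h1 ⟨0, hn⟩
    rw [h, AlgEquiv.one_apply] at h1'
    have hX0 : (X (0, (⟨0, hn⟩ : Fin n)) : MvPolynomial (Fin 2 × Fin n) k) = 0 := by
      have := congrArg (fun f => f - X (1, (⟨0, hn⟩ : Fin n))) h1'
      simp only [sub_self, add_sub_cancel_left] at this
      exact this.symm
    exact MvPolynomial.X_ne_zero _ hX0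
  refine ⟨hpow, hne, ?_⟩
  rw [Nat.card_zpowers, orderOf_eq_prime hpow hne]

include h0 h1 in
/-- **`x_{0,i}` lies in the augmentation ideal of every non-trivial `g ∈ ⟨σ⟩`** (characteristic
`p`): `g = σᵐ` with `p ∤ m` and `g • x_{1,i} - x_{1,i} = m x_{0,i}`. [folklore] -/
theorem X_fst_mem_augIdeal (p : ℕ) (hp : p.Prime) [CharP k p] (g : Subgroup.zpowers σ)
    (hg : g ≠ 1) (i : Fin n) :
    (X (0, i) : MvPolynomial (Fin 2 × Fin n) k) ∈
      Ideal.span (Set.range fun b : MvPolynomial (Fin 2 × Fin n) k => g • b - b) := by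
  classical
  have hn : 0 < n := Fin.pos i
  obtain ⟨hσp, -, -⟩ := nBlocks_order k n σ h0 h1 p hp hn
  have hfin : IsOfFinOrder σ := isOfFinOrder_iff_pow_eq_one.mpr ⟨p, hp.pos, hσp⟩
  obtain ⟨m, hm⟩ : (g : MvPolynomial (Fin 2 × Fin n) k ≃ₐ[k] MvPolynomial (Fin 2 × Fin n) k) ∈
      Submonoid.powers σ := hfin.mem_powers_iff_mem_zpowers.mpr g.2
  have hm' : σ ^ m = (g : MvPolynomial (Fin 2 × Fin n) k ≃ₐ[k] MvPolynomial (Fin 2 × Fin n) k) := hm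
  have hndvd : ¬ p ∣ m := by
    rintro ⟨l, rfl⟩
    apply hg
    apply Subtype.ext
    change (g : MvPolynomial (Fin 2 × Fin n) k ≃ₐ[k] MvPolynomial (Fin 2 × Fin n) k) = 1
    rw [← hm', pow_mul, hσp, one_pow]
  have hmk : (m : k) ≠ 0 := fun h => hndvd ((CharP.cast_eq_zero_iff k p m).mp h)
  obtain ⟨-, e1⟩ := nBlocks_pow_apply_X k n σ h0 h1 m i
  have hsmul : g • (X (1, i) : MvPolynomial (Fin 2 × Fin n) k) - X (1, i) =
      (m : MvPolynomial (Fin 2 × Fin n) k) * X (0, i) := by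
    change (g : MvPolynomial (Fin 2 × Fin n) k ≃ₐ[k] MvPolynomial (Fin 2 × Fin n) k) (X (1, i)) -
      X (1, i) = _
    rw [← hm', e1]
    ring
  have hx : (X (0, i) : MvPolynomial (Fin 2 × Fin n) k) =
      C ((m : k)⁻¹) * (g • (X (1, i) : MvPolynomial (Fin 2 × Fin n) k) - X (1, i)) := by
    rw [hsmul, ← mul_assoc, ← map_natCast (C : k →+* MvPolynomial (Fin 2 × Fin n) k) m,
      ← map_mul, inv_mul_cancel₀ hmk, map_one, one_mul]
  rw [hx]
  exact Ideal.mul_mem_left _ _ (Ideal.subset_span ⟨X (1, i), rfl⟩)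

include h0 h1 in
/-- **On `𝔸²ⁿ` the augmentation ideal of every `g ≠ 1` in `⟨σ⟩` is the centre**
`I = (x_{0,i} : i)` (characteristic `p`). [folklore] -/
theorem augIdeal_eq_centre (p : ℕ) (hp : p.Prime) [CharP k p] (g : Subgroup.zpowers σ)
    (hg : g ≠ 1) :
    Ideal.span (Set.range fun r : MvPolynomial (Fin 2 × Fin n) k => g • r - r) =
      Ideal.span (Set.range fun i : Fin n => (X (0, i) : MvPolynomial (Fin 2 × Fin n) k)) := by
  apply le_antisymm
  · refine Ideal.span_le.mpr ?_
    rintro _ ⟨r, rfl⟩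
    exact smul_sub_mem_centre k n σ h0 h1 g r
  · refine Ideal.span_le.mpr ?_
    rintro _ ⟨i, rfl⟩
    exact X_fst_mem_augIdeal k n σ h0 h1 p hp g hg i

end Summit.ResolutionOfSingularities.ResolutionOfSingularities.Theorems.WildQuotientResolution.NBlocks

end
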